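import Literature.NumberTheory.GaloisRepresentations.ClosureValuationSubring
import Literature.NumberTheory.DiophantineGeometry.AbelianSchemeModelReduction
import Literature.AlgebraicGeometry.Motives.ProperIntegralPoints
import Mathlib.RingTheory.DedekindDomain.IntegralClosure
import Mathlib.FieldTheory.IntermediateField.Adjoin.Basic
import HarnessLib

/-!
# Points of a scheme locally of finite type with values in the valuation ring of `Ω = F̄` factor through a
# FINITE STAGE `integralClosure 𝒪[F] L`, `[L : F] < ∞` ([EGAIV3] 8.8.2 / [NeukirchANT1999] II (4.8); [Liu2002] 10.1.38)

Topic `Literature/AlgebraicGeometry/Motives`, namespace `Literature.AlgebraicGeometry.Motives`.  THEOREMS ONLY (no definition, no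
named fact, no instance, no notation, no `sorry`).  Cell `hodgecm-mathlib` (D-0151), programme F0∕P6 «MOD», organ **(ν1)** of the G1c
«ROOF REDUCTION» remainder (A-p17 (g26) FINDING 2026-09-01 «G1c BASE IS NOT DEDEKIND»): the integral point of record
`x̃ := extendPoint R _ 𝓨 (modelPointsEquiv⁻¹ x)` along which ★ `IntegralModel.geomReductionMap` reduces is an `R`-point with
`R =` ★ `closureValuationSubring F` — the valuation ring of `Ω = F̄` for the local field `F = K_v`, value group `ℚ`, NOT noetherian,
so that the ★ Néron engines (`AbelianSchemeOverGenericFibreExtension` §Extend, `IsogenyOfGenericIsogeny`), which bind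
`[IsDedekindDomain R]`, do not apply AT `R`.  This file supplies the reduction to a Dedekind base: every such point comes from a
point with values in a FINITE STAGE.

THE MATHEMATICS.  `R = {‖x‖ ≤ 1} ⊆ Ω` is, as a set, the integral closure of `𝒪[F]` in `Ω` (★
`mem_closureValuationSubring_iff_mem_absIntegers`, ★ `absIntegers 𝒪[F] F = integralClosure 𝒪[F] Ω`; [NeukirchANT1999] II (4.8)), and
`Ω = F̄` is algebraic over `F`.  Hence (§1) a finitely generated `O`-algebra `B` (any base ring `O → 𝒪[F]`) mapping to `R` over `O` maps
into `integralClosure 𝒪[F] L` for the intermediate field `L = F(images of the generators)`, which is FINITE over `F`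
(Mathlib `IntermediateField.finiteDimensional_adjoin`); and (§2) an `O`-morphism `l : Spec R → 𝒳` from the LOCAL scheme `Spec R` lands in
ONE affine open `U = Spec B ∋ l(𝔪_R)` (every point of `Spec R` specialises to the closed point; Mathlib `IsOpenImmersion.lift`) and is
`Spec` of a ring map `B → R` over `O` (`Spec` is fully faithful); for `𝒳` locally of finite type `B` is of finite type over `O`
(Mathlib `HasRingHomProperty.appLE`).  Together (§3): **`l = (Spec R → Spec R_L) ≫ z` for a finite `L∕F`, `R_L := integralClosure 𝒪[F] L`
and an `O`-morphism `z : Spec R_L → 𝒳`** — and `R_L` is a DEDEKIND domain with fraction field `L` when `F` has characteristic `0`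
(Mathlib `integralClosure.isDedekindDomain`, `integralClosure.isFractionRing_of_finite_extension`; §4), so ★ Néron applies over `R_L`
and reaches `R` by base change (organs (ν2)(ν3)).  §5 is the number-field reading (`F = K_v`, `O = 𝓞_{K,v}`, ★ `toClosureValuationSubring v
= integerToClosureValuationSubring ∘ toLocalInteger v`), the exact currency of ★ `IntegralModel.geomReductionMap` ∕
`AbelianSchemeFibreAlongIntegralPoint`.

* §1 `exists_intermediateField_ringHom_integralClosure` — finite-type `O`-algebras mapping to `R` map into a finite stage;
  `exists_ringHom_integralClosure_closureValuationSubring` — the inclusion `R_L → R` (characterised on elements; injective).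
* §2 `exists_isAffineOpen_ringHom_eq_of_isLocalRing` — an `O`-morphism from `Spec` of ANY local ring into ANY `O`-scheme is
  `Spec (B → R) ≫ (Spec B = U ↪ 𝒳)` for an affine open `U`, compatibly with the `O`-structures.
* §3 **`exists_finiteStage_comp_eq`** — THE HEAD (any nonarchimedean local field `F`, any `O → 𝒪[F]`, `𝒳` locally of finite type).
* §4 `isDedekindDomain_integralClosure`, `isFractionRing_integralClosure` — the stage is Dedekind with fraction field `L` (`char F = 0`).
* §5 `exists_finiteStage_comp_eq_numberField` — the reading at `R = closureValuationSubring (v.adicCompletion K)`, `toClosureValuationSubring v`.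

HONEST LABEL: HC_CM is proved only modulo the cell's 2 remaining named inputs (hLiu418 24832, h413 24833) until rung 0 closes; this file is
generic valuation∕scheme plumbing on `--supports stmt-HodgeConjecture-24832` and pays no letter by itself.

## References
* [EGAIV3] A. Grothendieck, J. Dieudonné, EGA IV₃ (Publ. Math. IHÉS 28, 1966), Thm. 8.8.2 (morphisms into a scheme locally of finite
  presentation descend to a stage of a projective system), Prop. 8.14.2.
* [NeukirchANT1999] J. Neukirch, *Algebraic Number Theory* (1999), Ch. II (4.8) (the valuation ring of `F̄` is the integral closure of
  `𝒪[F]`), Ch. II (6.2).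
* [Liu2002] Q. Liu, *Algebraic Geometry and Arithmetic Curves* (2002), §10.1.3, Cor. 10.1.38 and its proof («`𝒪_{K̄}` dominates
  `𝒪_{Z,x̃}`»; points with values in a local ring factor through an affine neighbourhood of the centre), Prop. 3.2.2 / Exercise 2.3.13.
* [Hartshorne1977] R. Hartshorne, *Algebraic Geometry*, II Prop. 2.3 (morphisms into an affine scheme = ring maps), II.4.7.
* [GortzWedhorn2020] U. Görtz, T. Wedhorn, *Algebraic Geometry I*, 2nd ed., Prop. 3.4, Thm. 10.57.
-/

set_option autoImplicit false

noncomputable section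

-- `(specValuationSubring R f).left = Spec R` and `(Over.mk _).left` are definitional only above `instances` transparency
-- (as in ★ `ProperIntegralPoints` ∕ `IntegralModelReductionSurjectiveOnClosedPoints`).
set_option backward.isDefEq.respectTransparency false

open ValuativeRel CategoryTheory AlgebraicGeometry IsLocalRing
open Literature.NumberTheory.GaloisRepresentations

universe u

namespace Literature.AlgebraicGeometry.Motives

/-! ## §1 Algebra: finite-type algebras mapping to `R = 𝒪_{F̄}` map into a finite stage -/

section Algebra

variable {F : Type u} [Field F] [ValuativeRel F] [TopologicalSpace F] [IsNonarchimedeanLocalField F]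

/-- **A finitely generated `O`-algebra mapping to the valuation ring `R` of `F̄` maps into a finite stage.**  For a base ring `O`
with `f₀ : O → 𝒪[F]`, a finite-type `O`-algebra `B` and a ring map `φ : B → R = closureValuationSubring F` over `O`
(`φ ∘ (O → B) = (𝒪[F] → R) ∘ f₀`), there are an intermediate field `F ⊆ L ⊆ F̄` FINITE over `F` and a ring map
`φ′ : B → integralClosure 𝒪[F] L` with the same values in `F̄`.  Proof: `L := F(φ(b₁), …, φ(bₙ))` for `O`-algebra generators `bᵢ`
(each `φ(bᵢ) ∈ F̄` is algebraic over `F`); the `b` with `φ b ∈ L` form an `O`-subalgebra containing the `bᵢ`; every element of `R` is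
integral over `𝒪[F]` ([NeukirchANT1999] II (4.8): `R` is the integral closure of `𝒪[F]` in `F̄`, ★ `mem_closureValuationSubring_iff_mem_absIntegers`).
[cite: NeukirchANT1999, Ch. II (4.8)] [cite: EGAIV3, Thm. 8.8.2] -/
theorem exists_intermediateField_ringHom_integralClosure {O : Type*} [CommRing O] (f₀ : O →+* 𝒪[F])
    {B : Type*} [CommRing B] [Algebra O B] [Algebra.FiniteType O B]
    (φ : B →+* closureValuationSubring F)
    (hφ : φ.comp (algebraMap O B) = (integerToClosureValuationSubring F).comp f₀) :
    ∃ (L : IntermediateField F (AlgebraicClosure F)) (_ : FiniteDimensional F L)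
      (φ' : B →+* integralClosure 𝒪[F] L),
      ∀ b, (((φ' b : integralClosure 𝒪[F] L) : L) : AlgebraicClosure F) = (φ b : AlgebraicClosure F) := by
  classical
  obtain ⟨s, hs⟩ := Algebra.FiniteType.out (R := O) (A := B)
  let S : Set (AlgebraicClosure F) := (fun b : B => ((φ b : closureValuationSubring F) : AlgebraicClosure F)) '' (s : Set B)
  haveI : Finite S := (s.finite_toSet.image _).to_subtype
  have hSint : ∀ x ∈ S, IsIntegral F x := fun x _ => Algebra.IsIntegral.isIntegral x
  let L : IntermediateField F (AlgebraicClosure F) := IntermediateField.adjoin F S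
  haveI : FiniteDimensional F L := IntermediateField.finiteDimensional_adjoin hSint
  -- every `φ b` lies in `L`
  have hmem : ∀ b : B, ((φ b : closureValuationSubring F) : AlgebraicClosure F) ∈ L := by
    let T : Subalgebra O B :=
      { carrier := {b | ((φ b : closureValuationSubring F) : AlgebraicClosure F) ∈ L}
        mul_mem' := fun {a b} ha hb => by
          simp only [Set.mem_setOf_eq, map_mul, MulMemClass.coe_mul] at ha hb ⊢
          exact L.mul_mem ha hb
        add_mem' := fun {a b} ha hb => by
          simp only [Set.mem_setOf_eq, map_add, AddMemClass.coe_add] at ha hb ⊢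
          exact L.add_mem ha hb
        algebraMap_mem' := fun o => by
          simp only [Set.mem_setOf_eq]
          have h1 : φ (algebraMap O B o) = integerToClosureValuationSubring F (f₀ o) := RingHom.congr_fun hφ o
          rw [h1, coe_integerToClosureValuationSubring, IsScalarTower.algebraMap_apply 𝒪[F] F (AlgebraicClosure F)]
          exact L.algebraMap_mem _ }
    have hT : T = ⊤ := by
      rw [eq_top_iff, ← hs]
      exact Algebra.adjoin_le fun b hb => IntermediateField.subset_adjoin F S ⟨b, hb, rfl⟩
    intro b
    have hb : b ∈ T := by rw [hT]; exact Algebra.mem_top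
    exact hb
  -- and is integral over `𝒪[F]` (`R` is the integral closure of `𝒪[F]` in `F̄`)
  have hint : ∀ b : B, IsIntegral 𝒪[F] (⟨((φ b : closureValuationSubring F) : AlgebraicClosure F), hmem b⟩ : L) := by
    intro b
    have h1 : ((φ b : closureValuationSubring F) : AlgebraicClosure F) ∈ absIntegers 𝒪[F] F :=
      mem_closureValuationSubring_iff_mem_absIntegers.mp (φ b).2
    have h2 : IsIntegral 𝒪[F] ((φ b : closureValuationSubring F) : AlgebraicClosure F) := h1
    rw [← isIntegral_algHom_iff ((IntermediateField.val L).restrictScalars 𝒪[F]) Subtype.val_injective]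
    exact h2
  refine ⟨L, inferInstance,
    { toFun := fun b => ⟨⟨((φ b : closureValuationSubring F) : AlgebraicClosure F), hmem b⟩, hint b⟩
      map_one' := Subtype.ext (Subtype.ext (by simp))
      map_mul' := fun a b => Subtype.ext (Subtype.ext (by simp))
      map_zero' := Subtype.ext (Subtype.ext (by simp))
      map_add' := fun a b => Subtype.ext (Subtype.ext (by simp)) }, fun b => rfl⟩

/-- **The finite stage embeds in `R`**: for an intermediate field `F ⊆ L ⊆ F̄` there is a ring map
`h : integralClosure 𝒪[F] L → R = closureValuationSubring F` with `h x = x` in `F̄` (elements integral over `𝒪[F]` have `‖x‖ ≤ 1`: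
★ `mem_closureValuationSubring_iff_mem_absIntegers`), and `h` is injective. [cite: NeukirchANT1999, Ch. II (4.8)] -/
theorem exists_ringHom_integralClosure_closureValuationSubring (L : IntermediateField F (AlgebraicClosure F)) :
    ∃ h : integralClosure 𝒪[F] L →+* closureValuationSubring F,
      (∀ x, ((h x : closureValuationSubring F) : AlgebraicClosure F) = ((x : L) : AlgebraicClosure F)) ∧
      Function.Injective h := by
  have hmem : ∀ x : integralClosure 𝒪[F] L, ((x : L) : AlgebraicClosure F) ∈ closureValuationSubring F := by
    intro x
    rw [mem_closureValuationSubring_iff_mem_absIntegers]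
    change IsIntegral 𝒪[F] (((IntermediateField.val L).restrictScalars 𝒪[F]) (x : L))
    exact x.2.map _
  refine ⟨{ toFun := fun x => ⟨((x : L) : AlgebraicClosure F), hmem x⟩
            map_one' := Subtype.ext (by simp)
            map_mul' := fun a b => Subtype.ext (by simp)
            map_zero' := Subtype.ext (by simp)
            map_add' := fun a b => Subtype.ext (by simp) }, fun x => rfl, ?_⟩
  intro x y hxy
  have h1 : ((x : L) : AlgebraicClosure F) = ((y : L) : AlgebraicClosure F) :=
    congrArg (fun t : closureValuationSubring F => (t : AlgebraicClosure F)) hxy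
  exact Subtype.ext (Subtype.ext h1)

end Algebra

/-! ## §2 Schemes: a point with values in a local ring lands in one affine open -/

section LocalPoint

variable {O : Type u} [CommRing O] {R : Type u} [CommRing R] [IsLocalRing R]

/-- **A local-ring-valued point of an `O`-scheme is `Spec` of a ring map into an affine open.**  For an `O`-morphism
`l : Spec R → 𝒳` with `R` LOCAL there are an affine open `U = Spec B` of `𝒳` and a ring map `φ : B = Γ(𝒳, U) → R` with
`l = Spec φ ≫ (Spec B ↪ 𝒳)` (★ Mathlib `IsAffineOpen.fromSpec`) and `φ ∘ (O → B) = f`, where `O → B` is the structure map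
`Γ(Spec O) → Γ(𝒳, U)` of `𝒳 → Spec O`.  Proof: every point of `Spec R` specialises to the closed point, so `l` lands in any open
neighbourhood `U` of `l(𝔪_R)` — take `U` affine (Mathlib `IsOpenImmersion.lift`); morphisms `Spec R → Spec B` are ring maps (`Spec`
fully faithful); the compatibility with `O` is read off `l ≫ (𝒳 → Spec O) = Spec f` through ★ `IsAffineOpen.SpecMap_appLE_fromSpec`.
[cite: Liu2002, §10.1.3, proof of Cor. 10.1.38; Prop. 3.2.2] [cite: Hartshorne1977, II Prop. 2.3] -/
theorem exists_isAffineOpen_ringHom_eq_of_isLocalRing (f : O →+* R) (𝒳 : SchemeOver O)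
    (l : Over.mk (Spec.map (CommRingCat.ofHom f)) ⟶ 𝒳) :
    ∃ (U : 𝒳.left.Opens) (hU : IsAffineOpen U) (φ : Γ(𝒳.left, U) →+* R),
      l.left.base (closedPoint R) ∈ U ∧
      Spec.map (CommRingCat.ofHom φ) ≫ hU.fromSpec = l.left ∧
      φ.comp ((𝒳.hom.appLE ⊤ U le_top).hom.comp (Scheme.ΓSpecIso (CommRingCat.of O)).inv.hom) = f := by
  set x₀ := l.left.base (closedPoint R) with hx₀
  obtain ⟨U, hU, hxU⟩ : ∃ U : 𝒳.left.Opens, IsAffineOpen U ∧ x₀ ∈ U := by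
    obtain ⟨_, ⟨U, hU, rfl⟩, hxU, -⟩ := 𝒳.left.isBasis_affineOpens.exists_subset_of_mem_open (Set.mem_univ x₀) isOpen_univ
    exact ⟨U, hU, hxU⟩
  -- the whole of `Spec R` lands in `U`
  have hrange : Set.range l.left.base ⊆ Set.range U.ι.base := by
    rw [Scheme.Opens.range_ι]
    rintro _ ⟨p, rfl⟩
    have hp : (p : PrimeSpectrum R) ⤳ closedPoint R := by
      rw [← PrimeSpectrum.le_iff_specializes]
      exact IsLocalRing.le_maximalIdeal p.2.ne_top
    exact (hp.map l.left.base.hom.continuous).mem_open U.2 hxU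
  let m : Spec (CommRingCat.of R) ⟶ (U : Scheme.{u}) := IsOpenImmersion.lift U.ι l.left hrange
  have hm : m ≫ U.ι = l.left := IsOpenImmersion.lift_fac U.ι l.left hrange
  let φ₁ : Γ(𝒳.left, U) ⟶ CommRingCat.of R := Spec.preimage (m ≫ hU.isoSpec.hom)
  have hφ₁ : Spec.map φ₁ ≫ hU.fromSpec = l.left := by
    rw [Spec.map_preimage, Category.assoc, ← IsAffineOpen.isoSpec_inv_ι, Iso.hom_inv_id_assoc, hm]
  refine ⟨U, hU, φ₁.hom, hxU, hφ₁, ?_⟩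
  -- compatibility with the `O`-structures
  have hw : l.left ≫ 𝒳.hom = Spec.map (CommRingCat.ofHom f) := Over.w l
  rw [← hφ₁, Category.assoc, ← IsAffineOpen.SpecMap_appLE_fromSpec 𝒳.hom (isAffineOpen_top _) hU le_top,
    IsAffineOpen.fromSpec_top, Scheme.isoSpec_Spec_inv, ← Spec.map_comp, ← Spec.map_comp] at hw
  have hw' := congrArg CommRingCat.Hom.hom (Spec.map_injective hw)
  simpa only [CommRingCat.hom_comp, CommRingCat.hom_ofHom] using hw'

end LocalPoint

/-! ## §3 The head: `R`-points of a scheme locally of finite type factor through a finite stage -/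

section Head

variable {F : Type u} [Field F] [ValuativeRel F] [TopologicalSpace F] [IsNonarchimedeanLocalField F]
  {O : Type u} [CommRing O]

/-- **`R`-points of an `O`-scheme locally of finite type factor through a finite stage.**  Let `F` be a nonarchimedean local field,
`R = closureValuationSubring F` the valuation ring of `F̄`, `f₀ : O → 𝒪[F]` a base ring (so `Spec R` is an `O`-scheme through
`O → 𝒪[F] → R`), and `𝒳 → Spec O` locally of finite type.  For every `O`-morphism `l : Spec R → 𝒳` there are an intermediate field
`F ⊆ L ⊆ F̄` FINITE over `F`, the ring map `h : R_L := integralClosure 𝒪[F] L → R` (`h x = x` in `F̄`), and an `O`-morphism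
`z : Spec R_L → 𝒳` (`Spec R_L` over `O` through `g := (𝒪[F] → R_L) ∘ f₀`) with **`Spec h ≫ z = l`** — both on underlying schemes
and in `SchemeOver O`; moreover `h ∘ g = (𝒪[F] → R) ∘ f₀`.  (§2 puts `l` in an affine open `Spec B`, `B` of finite type over `O`
(Mathlib `HasRingHomProperty.appLE` for `LocallyOfFiniteType`); §1 factors `B → R` through `R_L`.)  With §4, `R_L` is a Dedekind domain
with fraction field `L` when `char F = 0`: the base over which ★ Néron (`AbelianSchemeOverGenericFibreExtension`, `IsogenyOfGenericIsogeny`)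
applies. [cite: EGAIV3, Thm. 8.8.2] [cite: Liu2002, §10.1.3, Cor. 10.1.38] [cite: NeukirchANT1999, Ch. II (4.8)] -/
theorem exists_finiteStage_comp_eq (f₀ : O →+* 𝒪[F]) (𝒳 : SchemeOver O) [LocallyOfFiniteType 𝒳.hom]
    (l : specValuationSubring (closureValuationSubring F) ((integerToClosureValuationSubring F).comp f₀) ⟶ 𝒳) :
    ∃ (L : IntermediateField F (AlgebraicClosure F)) (_ : FiniteDimensional F L)
      (h : integralClosure 𝒪[F] L →+* closureValuationSubring F)
      (z : Over.mk (Spec.map (CommRingCat.ofHom ((algebraMap 𝒪[F] (integralClosure 𝒪[F] L)).comp f₀))) ⟶ 𝒳)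
      (w : Spec.map (CommRingCat.ofHom h) ≫
          Spec.map (CommRingCat.ofHom ((algebraMap 𝒪[F] (integralClosure 𝒪[F] L)).comp f₀)) =
        Spec.map (CommRingCat.ofHom ((integerToClosureValuationSubring F).comp f₀))),
      (∀ x, ((h x : closureValuationSubring F) : AlgebraicClosure F) = ((x : L) : AlgebraicClosure F)) ∧
      Function.Injective h ∧
      h.comp ((algebraMap 𝒪[F] (integralClosure 𝒪[F] L)).comp f₀) = (integerToClosureValuationSubring F).comp f₀ ∧
      Spec.map (CommRingCat.ofHom h) ≫ z.left = l.left ∧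
      (Over.homMk (Spec.map (CommRingCat.ofHom h)) w :
          specValuationSubring (closureValuationSubring F) ((integerToClosureValuationSubring F).comp f₀) ⟶
            Over.mk (Spec.map (CommRingCat.ofHom ((algebraMap 𝒪[F] (integralClosure 𝒪[F] L)).comp f₀)))) ≫ z = l := by
  -- §2: `l = Spec φ ≫ (Spec B ↪ 𝒳)` with `B = Γ(𝒳, U)` of finite type over `O`
  obtain ⟨U, hU, φ, -, hφl, hφO⟩ :=
    exists_isAffineOpen_ringHom_eq_of_isLocalRing ((integerToClosureValuationSubring F).comp f₀) 𝒳 l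
  let φO : O →+* Γ(𝒳.left, U) := (𝒳.hom.appLE ⊤ U le_top).hom.comp (Scheme.ΓSpecIso (CommRingCat.of O)).inv.hom
  letI : Algebra O Γ(𝒳.left, U) := φO.toAlgebra
  have hsurj : Function.Surjective (Scheme.ΓSpecIso (CommRingCat.of O)).inv.hom :=
    (Scheme.ΓSpecIso (CommRingCat.of O)).commRingCatIsoToRingEquiv.symm.bijective.2
  haveI : Algebra.FiniteType O Γ(𝒳.left, U) :=
    (HasRingHomProperty.appLE @LocallyOfFiniteType (f := 𝒳.hom) inferInstance ⟨⊤, isAffineOpen_top _⟩ ⟨U, hU⟩ le_top).comp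
      (RingHom.FiniteType.of_surjective _ hsurj)
  -- §1: `φ` factors through a finite stage
  obtain ⟨L, hL, φ', hφ'⟩ := exists_intermediateField_ringHom_integralClosure f₀ φ hφO
  obtain ⟨h, hh, hhinj⟩ := exists_ringHom_integralClosure_closureValuationSubring (F := F) L
  have hhφ' : h.comp φ' = φ := by
    ext b
    exact (hh (φ' b)).trans (hφ' b)
  -- `h ∘ g = f`
  have hhg : h.comp ((algebraMap 𝒪[F] (integralClosure 𝒪[F] L)).comp f₀) = (integerToClosureValuationSubring F).comp f₀ := by
    ext o
    change ((h (algebraMap 𝒪[F] (integralClosure 𝒪[F] L) (f₀ o)) : closureValuationSubring F) : AlgebraicClosure F) =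
      ((integerToClosureValuationSubring F (f₀ o) : closureValuationSubring F) : AlgebraicClosure F)
    rw [hh, coe_integerToClosureValuationSubring, Subalgebra.coe_algebraMap, IsScalarTower.algebraMap_apply 𝒪[F] F L,
      IsScalarTower.algebraMap_apply 𝒪[F] F (AlgebraicClosure F)]
    rfl
  -- `φ′ ∘ (O → B) = g` (compose with the injective `h`)
  have hφ'O : φ'.comp φO = (algebraMap 𝒪[F] (integralClosure 𝒪[F] L)).comp f₀ := by
    apply RingHom.ext
    intro o
    apply hhinj
    have e1 : h (φ' (φO o)) = φ (φO o) := RingHom.congr_fun hhφ' (φO o)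
    have e2 : φ (φO o) = integerToClosureValuationSubring F (f₀ o) := RingHom.congr_fun hφO o
    have e3 : h (algebraMap 𝒪[F] (integralClosure 𝒪[F] L) (f₀ o)) = integerToClosureValuationSubring F (f₀ o) :=
      RingHom.congr_fun hhg o
    change h (φ' (φO o)) = h (algebraMap 𝒪[F] (integralClosure 𝒪[F] L) (f₀ o))
    rw [e1, e2, e3]
  have w : Spec.map (CommRingCat.ofHom h) ≫
        Spec.map (CommRingCat.ofHom ((algebraMap 𝒪[F] (integralClosure 𝒪[F] L)).comp f₀)) =
      Spec.map (CommRingCat.ofHom ((integerToClosureValuationSubring F).comp f₀)) := by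
    rw [← Spec.map_comp, ← CommRingCat.ofHom_comp, hhg]
  -- the stage point `z := Spec φ′ ≫ (Spec B ↪ 𝒳)`
  have hz : (Spec.map (CommRingCat.ofHom φ') ≫ hU.fromSpec) ≫ 𝒳.hom =
      Spec.map (CommRingCat.ofHom ((algebraMap 𝒪[F] (integralClosure 𝒪[F] L)).comp f₀)) := by
    rw [Category.assoc, ← IsAffineOpen.SpecMap_appLE_fromSpec 𝒳.hom (isAffineOpen_top _) hU le_top, IsAffineOpen.fromSpec_top,
      Scheme.isoSpec_Spec_inv, ← Spec.map_comp, ← Spec.map_comp, ← hφ'O]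
    rfl
  have hzl : Spec.map (CommRingCat.ofHom h) ≫ (Spec.map (CommRingCat.ofHom φ') ≫ hU.fromSpec) = l.left := by
    rw [← Category.assoc, ← Spec.map_comp, ← CommRingCat.ofHom_comp, hhφ', hφl]
  refine ⟨L, hL, h, Over.homMk (Spec.map (CommRingCat.ofHom φ') ≫ hU.fromSpec) hz, w, hh, hhinj, hhg, hzl, ?_⟩
  ext : 1
  exact hzl

end Head

/-! ## §4 The stage is a Dedekind domain with fraction field `L` (characteristic `0`) -/

section Dedekind

variable {F : Type u} [Field F] [ValuativeRel F] [TopologicalSpace F] [IsNonarchimedeanLocalField F]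

/-- **The finite stage `integralClosure 𝒪[F] L` is a DEDEKIND DOMAIN** for `[L : F] < ∞` and `char F = 0` (`𝒪[F]` is a discrete valuation ring, `L∕F` is separable; Krull–Akizuki, Mathlib `integralClosure.isDedekindDomain`).
[cite: NeukirchANT1999, Ch. I (8.1) and Ch. II (6.2)] -/
theorem isDedekindDomain_integralClosure [CharZero F] (L : IntermediateField F (AlgebraicClosure F)) [FiniteDimensional F L] :
    IsDedekindDomain (integralClosure 𝒪[F] L) :=
  integralClosure.isDedekindDomain 𝒪[F] F L

omit [TopologicalSpace F] [IsNonarchimedeanLocalField F] in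
/-- **The fraction field of the finite stage is `L`.** [cite: NeukirchANT1999, Ch. I (8.1)] -/
theorem isFractionRing_integralClosure (L : IntermediateField F (AlgebraicClosure F)) [FiniteDimensional F L] :
    IsFractionRing (integralClosure 𝒪[F] L) L :=
  integralClosure.isFractionRing_of_finite_extension F L

omit [TopologicalSpace F] [IsNonarchimedeanLocalField F] in
/-- **The stage contains `𝒪[F]`**: the structure map `𝒪[F] → integralClosure 𝒪[F] L` is injective.
[cite: NeukirchANT1999, Ch. I (8.1)] -/
theorem algebraMap_integralClosure_injective (L : IntermediateField F (AlgebraicClosure F)) :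
    Function.Injective (algebraMap 𝒪[F] (integralClosure 𝒪[F] L)) := by
  intro a b hab
  have h1 : algebraMap 𝒪[F] L a = algebraMap 𝒪[F] L b := by
    simpa only [Subalgebra.coe_algebraMap] using congrArg Subtype.val hab
  rw [IsScalarTower.algebraMap_apply 𝒪[F] F L, IsScalarTower.algebraMap_apply 𝒪[F] F L] at h1
  exact Subtype.val_injective ((algebraMap F L).injective h1)

end Dedekind

/-! ## §5 The number-field reading: `F = K_v`, `O = 𝓞_{K,v}`, `R = closureValuationSubring (v.adicCompletion K)` -/

section NumberField

open IsDedekindDomain IsDedekindDomain.HeightOneSpectrum Literature.NumberTheory.DiophantineGeometry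
open scoped NumberField

variable {K : Type} [Field K] [NumberField K] (v : HeightOneSpectrum (𝓞 K))

/-- **`R`-points of an `𝓞ᵥ`-scheme locally of finite type factor through a finite stage** — the currency of ★
`IntegralModel.geomReductionMap` ∕ ★ `AbelianSchemeFibreAlongIntegralPoint`: `R = closureValuationSubring (v.adicCompletion K)`,
structure map ★ `toClosureValuationSubring v = integerToClosureValuationSubring ∘ toLocalInteger v` (definitionally).  For every
`𝓞ᵥ`-morphism `l : Spec R → 𝒳` (e.g. `l = extendPoint R _ 𝓨.total (𝓨.modelPointsEquiv.symm x)` of a proper model) there are a finite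
extension `K_v ⊆ L ⊆ Ω` inside `Ω = \overline{K_v}`, the inclusion `h : R_L = integralClosure 𝒪[K_v] L → R` and an `𝓞ᵥ`-morphism
`z : Spec R_L → 𝒳` with `Spec h ≫ z = l`; `R_L` is Dedekind with fraction field `L` (§4). [cite: EGAIV3, Thm. 8.8.2]
[cite: Liu2002, §10.1.3, Cor. 10.1.38] [cite: NeukirchANT1999, Ch. II (4.8)] -/
theorem exists_finiteStage_comp_eq_numberField (𝒳 : SchemeOver (valuationSubringAtPrime K v)) [LocallyOfFiniteType 𝒳.hom]
    (l : specValuationSubring (closureValuationSubring (v.adicCompletion K)) (toClosureValuationSubring v) ⟶ 𝒳) :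
    ∃ (L : IntermediateField (v.adicCompletion K) (AlgebraicClosure (v.adicCompletion K)))
      (_ : FiniteDimensional (v.adicCompletion K) L)
      (h : integralClosure 𝒪[v.adicCompletion K] L →+* closureValuationSubring (v.adicCompletion K))
      (z : Over.mk (Spec.map (CommRingCat.ofHom
          ((algebraMap 𝒪[v.adicCompletion K] (integralClosure 𝒪[v.adicCompletion K] L)).comp (toLocalInteger v)))) ⟶ 𝒳)
      (w : Spec.map (CommRingCat.ofHom h) ≫
          Spec.map (CommRingCat.ofHom
            ((algebraMap 𝒪[v.adicCompletion K] (integralClosure 𝒪[v.adicCompletion K] L)).comp (toLocalInteger v))) =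
        Spec.map (CommRingCat.ofHom (toClosureValuationSubring v))),
      (∀ x, ((h x : closureValuationSubring (v.adicCompletion K)) : AlgebraicClosure (v.adicCompletion K)) =
        ((x : L) : AlgebraicClosure (v.adicCompletion K))) ∧
      Function.Injective h ∧
      h.comp ((algebraMap 𝒪[v.adicCompletion K] (integralClosure 𝒪[v.adicCompletion K] L)).comp (toLocalInteger v)) =
        toClosureValuationSubring v ∧
      Spec.map (CommRingCat.ofHom h) ≫ z.left = l.left ∧
      (Over.homMk (Spec.map (CommRingCat.ofHom h)) w :
          specValuationSubring (closureValuationSubring (v.adicCompletion K)) (toClosureValuationSubring v) ⟶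
            Over.mk (Spec.map (CommRingCat.ofHom
              ((algebraMap 𝒪[v.adicCompletion K] (integralClosure 𝒪[v.adicCompletion K] L)).comp (toLocalInteger v))))) ≫
          z = l :=
  exists_finiteStage_comp_eq (toLocalInteger v) 𝒳 l

end NumberField

end Literature.AlgebraicGeometry.Motives

end
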